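import Summits.Ventures.HodgeRepro2.PicardExists
import Mathlib.LinearAlgebra.Matrix.Permutation

/-!
# HodgeRepro2 — frames exist; the hypotheses of `ShimuraThm81Instance` are satisfiable (proved)

Blind re-derivation cell `pub-hodge-repro2`, seat p2 (file 9; imports `PicardExists.lean`).
Everything here is PROVED.

## Main results
* `exists_frame_of_counts`: a hermitian complex `3×3` matrix with two positive and one negative
  eigenvalue is `Qᴴ J_{2,1} Q` for an invertible `Q` (spectral theorem
  `Matrix.IsHermitian.spectral_theorem`, a permutation matrix moving the negative eigenvalue to
  the last slot, and `diag(√|λ_i|)`): this is the frame `Q₁` of [Sh79] (4.2),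
  `-iT^{τ₁} = Q₁^ρ J_{r₁,s₁} ᵗQ₁`, in the convention `Qᴴ J Q = τ₁(H)` of `IsFrame`.
* `exists_isFrame`: hence `IsFrame K τ₁ H Q` is satisfiable whenever `signatureAt τ₁ H = (2,1)`.
* `exists_isLattice`: a full `ℤ`-lattice in `K³` exists (the `ℤ`-span of a `ℚ`-basis).
* `shimuraThm81Instance_hypotheses_satisfiable`: for every CM-field `K` and every embedding
  `τ₁`, there are `H`, `𝔪`, `Q` with `IsHermitianForm K H`, `IsPicardSignature K τ₁ H`,
  `IsLattice K 𝔪`, `IsFrame K τ₁ H Q` — the hypotheses of the instantiated non-vanishing input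
  `ShimuraThm81Instance K` are jointly satisfiable (no vacuity).

[Sh79] G. Shimura, J. Math. Soc. Japan 31 (1979) 561–592, §4 (4.2)–(4.3).
-/

namespace Summit.Ventures.HodgeRepro2.ShimuraData

open NumberField Matrix

section Frame

/-- `S * E * S = D` for the real diagonal data `s_i = √|λ_i|`, `e_i = sign λ_i`. -/
theorem diag_sqrt_sign (lam : Fin 3 → ℝ) (e : Fin 3 → ℂ)
    (he : ∀ i, (lam i < 0 → e i = -1) ∧ (0 < lam i → e i = 1)) (hne : ∀ i, lam i ≠ 0) :
    diagonal (fun i => (Real.sqrt |lam i| : ℂ)) * diagonal e *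
        diagonal (fun i => (Real.sqrt |lam i| : ℂ)) =
      diagonal (fun i => (lam i : ℂ)) := by
  rw [diagonal_mul_diagonal, diagonal_mul_diagonal]
  congr 1
  funext i
  have hsq : ((Real.sqrt |lam i| : ℂ)) * (Real.sqrt |lam i| : ℂ) = ((|lam i| : ℝ) : ℂ) := by
    rw [← Complex.ofReal_mul, Real.mul_self_sqrt (abs_nonneg _)]
  rcases lt_or_gt_of_ne (hne i) with h | h
  · rw [(he i).1 h]
    calc (Real.sqrt |lam i| : ℂ) * (-1) * (Real.sqrt |lam i| : ℂ)
        = -((Real.sqrt |lam i| : ℂ) * (Real.sqrt |lam i| : ℂ)) := by ring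
      _ = (lam i : ℂ) := by rw [hsq, abs_of_neg h]; push_cast; ring
  · rw [(he i).2 h]
    calc (Real.sqrt |lam i| : ℂ) * 1 * (Real.sqrt |lam i| : ℂ)
        = (Real.sqrt |lam i| : ℂ) * (Real.sqrt |lam i| : ℂ) := by ring
      _ = (lam i : ℂ) := by rw [hsq, abs_of_pos h]

/-- Conjugating `J_{2,1}` by the permutation matrix of `σ` gives the diagonal matrix with entries
`J_{2,1}(σ⁻¹ i, σ⁻¹ i)`. -/
theorem permMatrix_conj_J21 (σ : Equiv.Perm (Fin 3)) :
    (σ.permMatrix ℂ)ᴴ * J21 * σ.permMatrix ℂ =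
      diagonal (fun i => (![1, 1, -1] : Fin 3 → ℂ) (σ⁻¹ i)) := by
  rw [Matrix.conjTranspose_permMatrix, Equiv.Perm.permMatrix, Equiv.Perm.permMatrix,
    PEquiv.toMatrix_toPEquiv_mul, PEquiv.mul_toMatrix_toPEquiv, J21, submatrix_submatrix,
    Function.comp_id, Function.id_comp, Equiv.Perm.inv_def, submatrix_diagonal_equiv]
  rfl

/-- Count bookkeeping: if exactly two eigenvalues are positive and one is negative, then some
`k` has `λ_k < 0` and every `i ≠ k` has `λ_i > 0`. -/
theorem exists_neg_index (lam : Fin 3 → ℝ)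
    (hpos : (Finset.univ.filter fun i => 0 < lam i).card = 2)
    (hneg : (Finset.univ.filter fun i => lam i < 0).card = 1) :
    ∃ k, lam k < 0 ∧ ∀ i, i ≠ k → 0 < lam i := by
  classical
  obtain ⟨k, hk⟩ := Finset.card_eq_one.mp hneg
  have hkmem : k ∈ Finset.univ.filter fun i => lam i < 0 := by rw [hk]; exact Finset.mem_singleton_self k
  have hkneg : lam k < 0 := (Finset.mem_filter.mp hkmem).2
  refine ⟨k, hkneg, fun i hi => ?_⟩
  -- `i` is not negative (else it would be `k`) and not zero (cardinality), hence positive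
  have hnotneg : ¬ lam i < 0 := by
    intro h
    have : i ∈ ({k} : Finset (Fin 3)) := by
      rw [← hk]; exact Finset.mem_filter.mpr ⟨Finset.mem_univ _, h⟩
    exact hi (Finset.mem_singleton.mp this)
  by_contra hnotpos
  have hzero : lam i = 0 := le_antisymm (not_lt.mp hnotpos) (not_lt.mp hnotneg)
  -- the positive and negative sets are disjoint of total cardinality 3 = |Fin 3|, so they cover
  have hdisj : Disjoint (Finset.univ.filter fun i => 0 < lam i)
      (Finset.univ.filter fun i => lam i < 0) := by
    rw [Finset.disjoint_filter]
    intro j _ h1 h2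
    exact absurd (h1.trans h2) (lt_irrefl _)
  have hunion : ((Finset.univ.filter fun i => 0 < lam i) ∪
      (Finset.univ.filter fun i => lam i < 0)).card = 3 := by
    rw [Finset.card_union_of_disjoint hdisj, hpos, hneg]
  have hcover : ((Finset.univ.filter fun i => 0 < lam i) ∪
      (Finset.univ.filter fun i => lam i < 0)) = Finset.univ :=
    Finset.eq_univ_of_card _ (by rw [hunion]; simp)
  have : i ∈ ((Finset.univ.filter fun i => 0 < lam i) ∪
      (Finset.univ.filter fun i => lam i < 0)) := by rw [hcover]; exact Finset.mem_univ i
  rcases Finset.mem_union.mp this with h | h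
  · exact hnotpos (Finset.mem_filter.mp h).2
  · exact hnotneg (Finset.mem_filter.mp h).2

/-- Abstract frame identity: if `Pᴴ J P = E` and `S E S = D` with `S` self-adjoint, then
`Q = P S Uᴴ` satisfies `Qᴴ J Q = U D Uᴴ`. -/
theorem frame_identity (U S P J E D : Matrix (Fin 3) (Fin 3) ℂ) (hSH : Sᴴ = S)
    (hP : Pᴴ * J * P = E) (hSES : S * E * S = D) :
    (P * S * Uᴴ)ᴴ * J * (P * S * Uᴴ) = U * D * Uᴴ := by
  rw [conjTranspose_mul, conjTranspose_mul, conjTranspose_conjTranspose, hSH, ← hSES, ← hP]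
  simp only [Matrix.mul_assoc]

/-- **Frames exist**: for a hermitian complex `3×3` matrix `A` with exactly two positive and one
negative eigenvalue there is `Q` with `Qᴴ J_{2,1} Q = A` and `det Q ≠ 0` (spectral theorem +
a permutation putting the negative eigenvalue last + square roots of `|λ_i|`). -/
theorem exists_frame_of_counts (A : Matrix (Fin 3) (Fin 3) ℂ) (hA : A.IsHermitian)
    (hpos : (Finset.univ.filter fun i => 0 < hA.eigenvalues i).card = 2)
    (hneg : (Finset.univ.filter fun i => hA.eigenvalues i < 0).card = 1) :
    ∃ Q : Matrix (Fin 3) (Fin 3) ℂ, Qᴴ * J21 * Q = A ∧ IsUnit Q.det := by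
  classical
  obtain ⟨k, hk, hother⟩ := exists_neg_index hA.eigenvalues hpos hneg
  have hne : ∀ i, hA.eigenvalues i ≠ 0 := fun i => by
    by_cases hik : i = k
    · subst hik; exact hk.ne
    · exact (hother i hik).ne'
  set σ : Equiv.Perm (Fin 3) := Equiv.swap k 2 with hσ
  have hσinv : σ⁻¹ = σ := by
    rw [hσ, Equiv.Perm.inv_def, Equiv.symm_swap]
  set e : Fin 3 → ℂ := fun i => (![1, 1, -1] : Fin 3 → ℂ) (σ⁻¹ i) with he_def
  have hval : ∀ j : Fin 3, j ≠ 2 → (![1, 1, -1] : Fin 3 → ℂ) j = 1 := by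
    intro j hj
    fin_cases j
    · rfl
    · rfl
    · exact absurd rfl hj
  have he : ∀ i, (hA.eigenvalues i < 0 → e i = -1) ∧ (0 < hA.eigenvalues i → e i = 1) := by
    intro i
    constructor
    · intro hi
      have hik : i = k := by
        by_contra h; exact absurd hi (not_lt.mpr (hother i h).le)
      rw [he_def, hik]
      show (![1, 1, -1] : Fin 3 → ℂ) (σ⁻¹ k) = -1
      rw [hσinv, hσ, Equiv.swap_apply_left]
      rfl
    · intro hi
      have hik : i ≠ k := fun h => by rw [h] at hi; exact absurd hi (not_lt.mpr hk.le)
      have h2 : σ⁻¹ i ≠ 2 := by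
        intro h
        apply hik
        have := congrArg σ h
        rw [Equiv.Perm.inv_def, Equiv.apply_symm_apply] at this
        rw [this, hσ, Equiv.swap_apply_right]
      exact hval _ h2
  set U : Matrix (Fin 3) (Fin 3) ℂ := (hA.eigenvectorUnitary : Matrix (Fin 3) (Fin 3) ℂ) with hU
  set S : Matrix (Fin 3) (Fin 3) ℂ := diagonal (fun i => (Real.sqrt |hA.eigenvalues i| : ℂ))
    with hS
  have hD : diagonal (RCLike.ofReal ∘ hA.eigenvalues) =
      diagonal (fun i => (hA.eigenvalues i : ℂ)) := rfl
  have hspec : A = U * diagonal (fun i => (hA.eigenvalues i : ℂ)) * Uᴴ := by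
    have h := hA.spectral_theorem
    rw [Unitary.conjStarAlgAut_apply, star_eq_conjTranspose, hD] at h
    exact h
  have hSH : Sᴴ = S := by
    rw [hS, diagonal_conjTranspose]
    congr 1
    funext i
    simp [Complex.conj_ofReal]
  refine ⟨σ.permMatrix ℂ * S * Uᴴ, ?_, ?_⟩
  · rw [frame_identity U S (σ.permMatrix ℂ) J21 (diagonal e)
      (diagonal (fun i => (hA.eigenvalues i : ℂ))) hSH (permMatrix_conj_J21 σ)
      (by rw [hS]; exact diag_sqrt_sign hA.eigenvalues e he hne)]
    exact hspec.symm
  · rw [det_mul, det_mul, isUnit_iff_ne_zero]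
    refine mul_ne_zero (mul_ne_zero ?_ ?_) ?_
    · rw [det_permutation]
      exact_mod_cast (Units.ne_zero (Equiv.Perm.sign σ))
    · rw [hS, det_diagonal]
      exact Finset.prod_ne_zero_iff.mpr fun i _ => by
        exact_mod_cast (Real.sqrt_pos.mpr (abs_pos.mpr (hne i))).ne'
    · rw [det_conjTranspose]
      intro h0
      have hmem := Matrix.det_of_mem_unitary hA.eigenvectorUnitary.2
      have h1 := Unitary.star_mul_self_of_mem hmem
      rw [← hU] at h1
      rw [h0, zero_mul] at h1
      exact zero_ne_one h1

end Frame


section FrameCM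

variable (K : Type*) [Field K] [NumberField K] [IsCMField K]

/-- A frame exists for every hermitian form over a CM-field with signature `(2,1)` at `τ₁`:
`IsFrame K τ₁ H Q` is satisfiable (so the hypothesis `IsFrame` of `ShimuraThm81Instance` is not
vacuous). -/
theorem exists_isFrame {H : Matrix (Fin 3) (Fin 3) K} (hH : IsHermitianForm K H) (τ₁ : K →+* ℂ)
    (hsig : signatureAt K τ₁ H = (2, 1)) : ∃ Q, IsFrame K τ₁ H Q := by
  have hA := isHermitian_map_of_isHermitianForm hH τ₁
  unfold signatureAt at hsig
  rw [dif_pos hA] at hsig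
  obtain ⟨Q, hQ, hdet⟩ := exists_frame_of_counts (H.map τ₁) hA (Prod.mk.inj hsig).1
    (Prod.mk.inj hsig).2
  exact ⟨Q, hQ, hdet⟩

omit [IsCMField K] in
/-- A full `ℤ`-lattice in `K³` exists: the `ℤ`-span of a `ℚ`-basis. -/
theorem exists_isLattice : ∃ 𝔪 : Submodule ℤ (Fin 3 → K), IsLattice K 𝔪 := by
  let b := Module.finBasis ℚ (Fin 3 → K)
  refine ⟨Submodule.span ℤ (Set.range b), Module.Finite.span_of_finite ℤ (Set.finite_range b), ?_⟩
  apply top_unique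
  rw [← b.span_eq]
  exact Submodule.span_mono (Submodule.subset_span)

/-- **All hypotheses of `ShimuraThm81Instance` are simultaneously satisfiable** for every
CM-field `K` and every embedding `τ₁`: a hermitian `H` of Picard signature, a lattice `𝔪` and a
frame `Q` exist.  (Combines `picardHermitianFormExists`, `exists_isLattice`, `exists_isFrame`.) -/
theorem shimuraThm81Instance_hypotheses_satisfiable (τ₁ : K →+* ℂ) :
    ∃ (H : Matrix (Fin 3) (Fin 3) K) (𝔪 : Submodule ℤ (Fin 3 → K)) (Q : Matrix (Fin 3) (Fin 3) ℂ),
      IsHermitianForm K H ∧ IsPicardSignature K τ₁ H ∧ IsLattice K 𝔪 ∧ IsFrame K τ₁ H Q := by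
  obtain ⟨H, hH, hsig⟩ := picardHermitianFormExists K τ₁
  obtain ⟨𝔪, h𝔪⟩ := exists_isLattice K
  obtain ⟨Q, hQ⟩ := exists_isFrame K hH τ₁ hsig.1
  exact ⟨H, 𝔪, Q, hH, hsig, h𝔪, hQ⟩

end FrameCM

end Summit.Ventures.HodgeRepro2.ShimuraData
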